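import Summits.BirchSwinnertonDyer.BirchSwinnertonDyer.Theorems.GoldfeldAllTwistsTwoConverseTwinAdditiveTwoAdicPOne
import Summits.BirchSwinnertonDyer.BirchSwinnertonDyer.Theorems.GoldfeldAllTwistsTwoConverseTwinSplitSymbolQuartic
import HarnessLib

set_option linter.dupNamespace false -- namespace `…BirchSwinnertonDyer.BirchSwinnertonDyer…` is the cell's (D-0017 nested layout)
set_option autoImplicit false

/-!
# OBJECT A7⁺, tranche T1, file D⁺-1: the SHARP Selmer set `S(−42qp, 448q²p²) ⊆ {1, 7}` of `W = 49a1^{(−2qp)}` on the cell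
# a71+ (`q ≡ 7 (8)`, `(q/7) = −1`; `p ≡ 1 (8)`, `(−7/p) = 1`, `−7` NOT a fourth power mod `p`; `(p/q) = +1`) — FACT-FREE

Cell `bsd-goldfeld`, seat `bsd-goldfeld-s1p-c3x` (gen 15); planner RULING (ccclxxxii) ORDER «OBJECT A7⁺ BY THE χ_Z CHANNEL», tranche T1
(memo `HOME/PLUS-CHIZ-CHANNEL.md` §2 D⁺). `--supports stmt-BirchSwinnertonDyer-19140` as a HELPER. Theses-free; theorems only; no definition,
no fact binder, no `sorry`. FRONTIER-grade: a twist-density-ZERO sub-family; never distance-to-summit.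

WHY. On the `(p/q) = −1` cells C7/C7A the landed F9a/D1-W files (`…TwinAdditiveTwoPrimesTwistSelmerPOne`, `…SelmerSharpPOne`) kill the
four `p`-classes `p, 2p, 7p, 14p` of `S(W)` at the prime `q` (they are non-residues there BECAUSE `(p/q) = −1`). On a71+ (`(p/q) = +1`)
that kill is gone; the kit/kill-table census of the seat (memo §0: `S(W) = {1, 7}` on 20/20 a71+ rows, 0 undecided branches) says the
classes die elsewhere, and this file proves it: `p, 7p` die AT `p` — with `q` a square mod `p` the `p`-adic root condition of
`not_isSoluble_padic_of_prime_dvd_coeffs_of_roots` becomes «`V² − 42V + 448 = 0` with `V` a square», i.e. `21 + s ∈ 𝔽_p^{×2}` for some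
`s² = −7`, which is the NEGATION of the type-α symbol (c301's `symbolNeg_iff_not_exists_pow_four`, `−2 ∈ 𝔽_p^{×2}` at `p ≡ 1 (8)`) —
and `2p, 14p` die AT `2` (after the `ℚ₂`-rescalings `p ↦ 1`, `q ↦ −1` of `isSoluble_two_of_common_factor` / `isSoluble_two_of_sq_factor`
they are D0-(L2)'s numeric kills `(42; 2, 224)`, `(42; 14, 32)`). Everything else is F9a's argument verbatim (negatives at `ℝ`, the
`q`-classes at `q`, `2, 14` at `2` by D0-(L2) with `u = −qp ≡ 1 (mod 8)`).
* §1 `not_isSquare_of_sq_sub_fortyTwo_mul_add_of_alpha` (the `p`-adic key), the class kills `not_isSoluble_padic_class_p_plusPOneAlpha`,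
  `not_isSoluble_padic_class_sevenP_plusPOneAlpha`, `not_isSoluble_two_class_twoP_plusPOne`, `not_isSoluble_two_class_fourteenP_plusPOne`.
* §2 `twoIsogenySelmerGroup_twoPrimesTwist_subset_pair_plusPOneAlpha`: `S(−42qp, 448q²p²) ⊆ {1, 7}`; `card_… ≤ 2`.
HONEST FRAMING: a Selmer bound on a twist-density-ZERO cell; no `BSD(W,2)` is proved; items 19140 / 19350 / 20044 unchanged; BSD is not proved
by any of this.

References: [SilvermanAEC2009] Prop. X.4.9, Example X.4.10; [Serre1973] Ch. II §3.3 Thm 4; [CoatesLiTianZhai2015] §5 (type α / β).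
-/

noncomputable section

open scoped Classical

open WeierstrassCurve Literature.NumberTheory.EllipticCurves

namespace Summit.BirchSwinnertonDyer.BirchSwinnertonDyer.Theorems.GoldfeldGoodTwists

/-! ## §1 Local kills on a71+ -/

section Local
variable {q p : ℕ} [Fact q.Prime] [Fact p.Prime]

/-- A natural number not divisible by the prime `ℓ` is non-zero in `ZMod ℓ`, as an integer cast. [folklore] -/
private theorem intCast_ne_zero_of_not_dvd_plusPOneAlpha {l : ℕ} [Fact l.Prime] {n : ℕ} (h : ¬ l ∣ n) : ((n : ℤ) : ZMod l) ≠ 0 := by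
  rw [Int.cast_natCast, Ne, ZMod.natCast_eq_zero_iff]; exact h

/-- A prime `ℓ ≠ 2, 7` divides no `2^a·7^b`. [folklore] -/
private theorem not_dvd_two_pow_mul_seven_pow_plusPOneAlpha {l : ℕ} (hl : l.Prime) (hl2 : l ≠ 2) (hl7 : l ≠ 7) (a b : ℕ) :
    ¬ l ∣ 2 ^ a * 7 ^ b := by
  intro h
  rcases (Nat.Prime.dvd_mul hl).mp h with h | h
  · exact hl2 ((Nat.prime_dvd_prime_iff_eq hl Nat.prime_two).mp (hl.dvd_of_dvd_pow h))
  · exact hl7 ((Nat.prime_dvd_prime_iff_eq hl (by norm_num)).mp (hl.dvd_of_dvd_pow h))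

omit [Fact q.Prime] in
/-- **The `p`-adic key of type α at `p ≡ 1 (mod 8)`: no SQUARE `V ∈ 𝔽_p` satisfies `V² − 42V + 448 = 0`.** Such a `V` gives `s := V − 21`
with `s² = −7` and `21 + s = V` a square, so `2·((−s) − 21) = −2V` is a square (`−2 ∈ 𝔽_p^{×2}` for `p ≡ 1 (8)`), contradicting the
type-α symbol `∀ s, s² = −7 → 2(s − 21) ∉ 𝔽_p^{×2}` (`symbolNeg_iff_not_exists_pow_four`). [cite: CoatesLiTianZhai2015, §5 (type α)] -/
theorem not_isSquare_of_sq_sub_fortyTwo_mul_add_of_alpha (hp8 : p % 8 = 1) (hp7 : legendreSym p (-7) = 1)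
    (hα : ¬ ∃ x : ZMod p, x ^ 4 = -7) {V : ZMod p} (hV : V ^ 2 - 42 * V + 448 = 0) : ¬ IsSquare V := by
  have hp : p.Prime := Fact.out
  have hp2 : p ≠ 2 := by rintro rfl; norm_num at hp8
  have hσ := (symbolNeg_iff_not_exists_pow_four (p := p) (by omega)).mpr hα
  obtain ⟨h2, -, hm1⟩ := legendreSym_two_seven_neg_one_of_one_mod_eight hp8 hp7
  -- `−2` is a square mod `p`
  have hm2 : IsSquare ((-2 : ℤ) : ZMod p) := by
    have h20 : ((-2 : ℤ) : ZMod p) ≠ 0 := by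
      intro h
      have h' : ((2 : ℕ) : ZMod p) = 0 := by
        have e : ((-2 : ℤ) : ZMod p) = -((2 : ℕ) : ZMod p) := by push_cast; ring
        rw [e, neg_eq_zero] at h; exact h
      rw [ZMod.natCast_eq_zero_iff] at h'
      exact hp2 ((Nat.prime_dvd_prime_iff_eq hp Nat.prime_two).mp h')
    refine (legendreSym.eq_one_iff p h20).mp ?_
    rw [show (-2 : ℤ) = -1 * 2 by norm_num, legendreSym.mul, hm1, h2, one_mul]
  rintro ⟨Y, hY⟩
  obtain ⟨r, hr⟩ := hm2
  push_cast at hr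
  have hs : (-(V - 21)) ^ 2 = (-7 : ZMod p) := by linear_combination hV
  apply hσ (-(V - 21)) hs
  refine ⟨r * Y, ?_⟩
  rw [hY]
  linear_combination (Y * Y) * hr

omit [Fact q.Prime] in
/-- **Class `p ∈ S(−42qp, 448q²p²)` dies at `p` on a71+**: `d = p·1`, `d′ = p·448q²`, `a = p·(−42q)`; a square root `T` of
`448q²T² − 42qT + 1` gives the square `V = 448qT = 7q·(8·√T)²` (`7`, `q` squares mod `p`) with `V² − 42V + 448 = 0`.
[cite: SilvermanAEC2009, Prop. X.4.9 and Example X.4.10] -/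
theorem not_isSoluble_padic_class_p_plusPOneAlpha (hp8 : p % 8 = 1) (hp7 : legendreSym p (-7) = 1) (hα : ¬ ∃ x : ZMod p, x ^ 4 = -7)
    (h7sq : IsSquare ((7 : ℤ) : ZMod p)) (hqsq : IsSquare ((q : ℤ) : ZMod p)) (h448q : ((448 * (q : ℤ) ^ 2 : ℤ) : ZMod p) ≠ 0)
    {d d' : ℤ} (hd : d = p * (1 : ℤ)) (hd' : d' = p * (448 * (q : ℤ) ^ 2)) :
    ¬ ((twoIsogenyQuartic (-42 * ((q : ℤ) * p)) d d').map (Int.castRingHom ℚ_[p])).IsSoluble := by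
  refine not_isSoluble_padic_of_prime_dvd_coeffs_of_roots (p := p) (c := -42 * q) (e := 1) (e' := 448 * (q : ℤ) ^ 2) (by ring) hd hd'
    h448q (fun T hT ↦ ?_)
  rintro ⟨X, rfl⟩
  obtain ⟨t, ht⟩ := h7sq
  obtain ⟨r, hr⟩ := hqsq
  push_cast at ht hr hT
  refine not_isSquare_of_sq_sub_fortyTwo_mul_add_of_alpha hp8 hp7 hα (V := 448 * (q : ZMod p) * (X * X)) ?_ ⟨8 * t * r * X, ?_⟩
  · linear_combination (448 : ZMod p) * hT
  · linear_combination (64 * 7 * X * X) * hr + (64 * X * X * r * r) * ht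

omit [Fact q.Prime] in
/-- **Class `7p ∈ S(−42qp, 448q²p²)` dies at `p` on a71+**: `d = p·7`, `d′ = p·64q²`; a square root `T` of `64q²T² − 42qT + 7` gives the
square `V = 64qT = q·(8·√T)²` with `V² − 42V + 448 = 0`. [cite: SilvermanAEC2009, Prop. X.4.9 and Example X.4.10] -/
theorem not_isSoluble_padic_class_sevenP_plusPOneAlpha (hp8 : p % 8 = 1) (hp7 : legendreSym p (-7) = 1)
    (hα : ¬ ∃ x : ZMod p, x ^ 4 = -7) (hqsq : IsSquare ((q : ℤ) : ZMod p)) (h64q : ((64 * (q : ℤ) ^ 2 : ℤ) : ZMod p) ≠ 0)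
    {d d' : ℤ} (hd : d = p * (7 : ℤ)) (hd' : d' = p * (64 * (q : ℤ) ^ 2)) :
    ¬ ((twoIsogenyQuartic (-42 * ((q : ℤ) * p)) d d').map (Int.castRingHom ℚ_[p])).IsSoluble := by
  refine not_isSoluble_padic_of_prime_dvd_coeffs_of_roots (p := p) (c := -42 * q) (e := 7) (e' := 64 * (q : ℤ) ^ 2) (by ring) hd hd'
    h64q (fun T hT ↦ ?_)
  rintro ⟨X, rfl⟩
  obtain ⟨r, hr⟩ := hqsq
  push_cast at hr hT
  refine not_isSquare_of_sq_sub_fortyTwo_mul_add_of_alpha hp8 hp7 hα (V := 64 * (q : ZMod p) * (X * X)) ?_ ⟨8 * r * X, ?_⟩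
  · linear_combination (64 : ZMod p) * hT
  · linear_combination (64 * X * X) * hr

omit [Fact q.Prime] [Fact p.Prime] in
/-- **Class `2p ∈ S(−42qp, 448q²p²)` dies at `2`** (`q ≡ 7 (8)`, `p ≡ 1 (8)`): `p ↦ 1` (common factor), `q ↦ −1` (square factor) give
D0-(L2)'s numeric `(42; 2, 224)`. [cite: SilvermanAEC2009, Prop. X.4.9 and Example X.4.10] [cite: Serre1973, Ch. II §3.3 Thm 4] -/
theorem not_isSoluble_two_class_twoP_plusPOne (hq8 : q % 8 = 7) (hp8 : p % 8 = 1) {a d d' : ℤ} (ha : a = -42 * ((q : ℤ) * p))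
    (hd : d = 2 * (p : ℤ)) (hd' : d' = 224 * ((q : ℤ) ^ 2 * p)) : ¬ ((twoIsogenyQuartic a d d').map (Int.castRingHom ℚ_[2])).IsSoluble :=
  fun h ↦ by
  have h1 := isSoluble_two_of_common_factor (n := p) (n₀ := 1) (by omega) (a₀ := -42 * (q : ℤ)) (d₀ := 2) (e₀ := 224 * (q : ℤ) ^ 2)
    (by rw [ha]; ring) (by rw [hd]; ring) (by rw [hd']; ring) h
  have h2 := isSoluble_two_of_sq_factor (n := q) (n₀ := -1) (by omega) (a₁ := -42) (d := 1 * 2) (e₁ := 224) (by ring) (by ring) h1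
  norm_num at h2
  exact not_isSoluble_two_numeric_two_even_pOneAlpha h2

omit [Fact q.Prime] [Fact p.Prime] in
/-- **Class `14p ∈ S(−42qp, 448q²p²)` dies at `2`** (`q ≡ 7 (8)`, `p ≡ 1 (8)`): rescaled to D0-(L2)'s numeric `(42; 14, 32)`.
[cite: SilvermanAEC2009, Prop. X.4.9 and Example X.4.10] [cite: Serre1973, Ch. II §3.3 Thm 4] -/
theorem not_isSoluble_two_class_fourteenP_plusPOne (hq8 : q % 8 = 7) (hp8 : p % 8 = 1) {a d d' : ℤ} (ha : a = -42 * ((q : ℤ) * p))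
    (hd : d = 14 * (p : ℤ)) (hd' : d' = 32 * ((q : ℤ) ^ 2 * p)) : ¬ ((twoIsogenyQuartic a d d').map (Int.castRingHom ℚ_[2])).IsSoluble :=
  fun h ↦ by
  have h1 := isSoluble_two_of_common_factor (n := p) (n₀ := 1) (by omega) (a₀ := -42 * (q : ℤ)) (d₀ := 14) (e₀ := 32 * (q : ℤ) ^ 2)
    (by rw [ha]; ring) (by rw [hd]; ring) (by rw [hd']; ring) h
  have h2 := isSoluble_two_of_sq_factor (n := q) (n₀ := -1) (by omega) (a₁ := -42) (d := 1 * 14) (e₁ := 32) (by ring) (by ring) h1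
  norm_num at h2
  exact not_isSoluble_two_numeric_fourteen_even_pOneAlpha h2

end Local

/-! ## §2 `S(−42qp, 448q²p²) ⊆ {1, 7}` on a71+ -/

section SelmerS
variable {q p : ℕ} [Fact q.Prime] [Fact p.Prime]

set_option maxHeartbeats 400000 in -- sixteen positive classes, each with its local computation (as F9a)
/-- **`S(−42qp, 448q²p²) ⊆ {1, 7}`** for `q ≡ 7 (8)`, `(q/7) = −1`, `p ≡ 1 (8)`, `(−7/p) = 1`, `−7 ∉ 𝔽_p^{×4}` (type α), `(p/q) = +1`
(cell a71+): negatives at `ℝ`, the `q`-classes at `q`, `p, 7p` at `p` (type α), `2p, 14p, 2, 14` at `2`.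
[cite: SilvermanAEC2009, Prop. X.4.9 and Example X.4.10] -/
theorem twoIsogenySelmerGroup_twoPrimesTwist_subset_pair_plusPOneAlpha (hq8 : q % 8 = 7) (hq7 : jacobiSym q 7 = -1) (hp8 : p % 8 = 1)
    (hp7 : legendreSym p (-7) = 1) (hα : ¬ ∃ x : ZMod p, x ^ 4 = -7) (hpq : jacobiSym p q = 1) :
    twoIsogenySelmerGroup (-42 * ((q : ℤ) * p)) (448 * ((q : ℤ) * p) ^ 2) ⊆ ({1, 7} : Finset ℤ) := by
  have hq : q.Prime := Fact.out
  have hp : p.Prime := Fact.out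
  have hqZ : Prime (q : ℤ) := Nat.prime_iff_prime_int.mp hq
  have hpZ : Prime (p : ℤ) := Nat.prime_iff_prime_int.mp hp
  have hq0 : (q : ℤ) ≠ 0 := by exact_mod_cast hq.ne_zero
  have hp0 : (p : ℤ) ≠ 0 := by exact_mod_cast hp.ne_zero
  have hq4 : q % 4 = 3 := by omega
  have hp4 : p % 4 = 1 := by omega
  have hq2 : q ≠ 2 := by rintro rfl; norm_num at hq4
  have hp2 : p ≠ 2 := by rintro rfl; norm_num at hp4
  have hqp : q ≠ p := by rintro rfl; omega
  have hq7' : q ≠ 7 := by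
    rintro rfl; rw [jacobiSym.mod_left] at hq7; norm_num at hq7
  have hp7' : p ≠ 7 := by rintro rfl; norm_num at hp4
  obtain ⟨-, hm7q⟩ := legendreSym_seven_and_neg_seven_of_three_mod_four hq4 hq7
  obtain ⟨-, h7p, -⟩ := legendreSym_two_seven_neg_one_of_one_mod_eight hp8 hp7
  -- `(q/p) = (p/q) = +1`
  have hqp_p : legendreSym p q = 1 := by
    have h := legendreSym.quadratic_reciprocity_one_mod_four hp4 hq2
    rw [← jacobiSym.legendreSym.to_jacobiSym] at hpq
    rw [← h]; exact hpq
  -- non-vanishing modulo `q` and `p`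
  have hcq : ∀ a b : ℕ, (((2 ^ a * 7 ^ b : ℕ) : ℤ) : ZMod q) ≠ 0 := fun a b ↦
    intCast_ne_zero_of_not_dvd_plusPOneAlpha (not_dvd_two_pow_mul_seven_pow_plusPOneAlpha hq hq2 hq7' a b)
  have hcp : ∀ a b : ℕ, (((2 ^ a * 7 ^ b : ℕ) : ℤ) : ZMod p) ≠ 0 := fun a b ↦
    intCast_ne_zero_of_not_dvd_plusPOneAlpha (not_dvd_two_pow_mul_seven_pow_plusPOneAlpha hp hp2 hp7' a b)
  have hpq0 : (p : ZMod q) ≠ 0 := by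
    have := intCast_ne_zero_of_not_dvd_plusPOneAlpha (l := q) (fun h ↦ hqp ((Nat.prime_dvd_prime_iff_eq hq hp).mp h)); exact_mod_cast this
  have hqp0 : ((q : ℤ) : ZMod p) ≠ 0 :=
    intCast_ne_zero_of_not_dvd_plusPOneAlpha (l := p) (fun h ↦ hqp ((Nat.prime_dvd_prime_iff_eq hp hq).mp h).symm)
  have h2pq : ((2 * p : ℤ) : ZMod q) ≠ 0 := by
    have h2 := hcq 1 0; norm_num at h2; push_cast; exact mul_ne_zero (by exact_mod_cast h2) hpq0
  have hns_disc_q : ¬ IsSquare ((((-42 * p) ^ 2 - 4 * (448 * p ^ 2) : ℤ)) : ZMod q) := by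
    rw [show ((-42 * p) ^ 2 - 4 * (448 * p ^ 2) : ℤ) = -7 * (2 * p) ^ 2 by ring]
    exact not_isSquare_mul_sq_zmod h2pq ((legendreSym.eq_neg_one_iff q).mp hm7q)
  -- squares modulo `p`: `7`, `q`; non-vanishing of `448q²`, `64q²`
  have h7p0 : ((7 : ℤ) : ZMod p) ≠ 0 := by have := hcp 0 1; norm_num at this; exact_mod_cast this
  have h7sq : IsSquare ((7 : ℤ) : ZMod p) := (legendreSym.eq_one_iff p h7p0).mp h7p
  have hqsq : IsSquare ((q : ℤ) : ZMod p) := (legendreSym.eq_one_iff p hqp0).mp hqp_p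
  have h448q : ((448 * (q : ℤ) ^ 2 : ℤ) : ZMod p) ≠ 0 := by
    have h448 := hcp 6 1; norm_num at h448
    push_cast; exact mul_ne_zero (by exact_mod_cast h448) (pow_ne_zero 2 (by exact_mod_cast hqp0))
  have h64q : ((64 * (q : ℤ) ^ 2 : ℤ) : ZMod p) ≠ 0 := by
    have h64 := hcp 6 0; norm_num at h64
    push_cast; exact mul_ne_zero (by exact_mod_cast h64) (pow_ne_zero 2 (by exact_mod_cast hqp0))
  -- `u = −qp ≡ 1 (mod 8)` for the classes `2, 14`
  have h8 : (8 : ℤ) ∣ -((q : ℤ) * p) - 1 := by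
    have hqp8 : (q * p) % 8 = 7 := by rw [Nat.mul_mod, hq8, hp8]
    have h8n : (8 : ℤ) ∣ ((q * p : ℕ) : ℤ) + 1 := by omega
    have e : -((q : ℤ) * p) - 1 = -( ((q * p : ℕ) : ℤ) + 1) := by push_cast; ring
    rw [e]; exact (dvd_neg).mpr h8n
  have hb : (448 * ((q : ℤ) * p) ^ 2 : ℤ) ≠ 0 := by positivity
  intro d hd
  rw [mem_twoIsogenySelmerGroup_iff hb] at hd
  obtain ⟨hsqf, ⟨d', hdd'⟩, hloc⟩ := hd
  have hd'eq : (448 * ((q : ℤ) * p) ^ 2 : ℤ) / d = d' := by rw [hdd', Int.mul_ediv_cancel_left _ hsqf.ne_zero]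
  rw [hd'eq] at hloc
  obtain ⟨hreal, hpadic⟩ := hloc
  -- negatives die at `ℝ`
  have hdpos : 0 < d := by
    rcases lt_or_gt_of_ne hsqf.ne_zero with hneg | hpos
    · exfalso
      have hbpos : (0 : ℤ) < 448 * ((q : ℤ) * p) ^ 2 := by positivity
      have hd'neg : d' < 0 := by
        by_contra hcon
        nlinarith [mul_nonpos_iff.mpr (Or.inr ⟨hneg.le, le_of_not_gt hcon⟩)]
      have ha : (-42 * ((q : ℤ) * p)) ≤ 0 := by
        have : (0 : ℤ) ≤ (q : ℤ) * p := by positivity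
        linarith
      exact not_isSoluble_real_twoIsogenyQuartic_of_neg hneg hd'neg ha hreal
    · exact hpos
  -- the `q`-classes die at `q`
  have hqd : ¬ (q : ℤ) ∣ d := by
    rintro ⟨e, rfl⟩
    have h1 : e * d' = 448 * q * p ^ 2 := mul_left_cancel₀ hq0 (by linear_combination (-1 : ℤ) * hdd')
    have h3 : (q : ℤ) ∣ e * d' := ⟨448 * p ^ 2, by rw [h1]; ring⟩
    rcases hqZ.dvd_or_dvd h3 with h4 | h4
    · obtain ⟨e₁, rfl⟩ := h4
      exact hqZ.not_unit (hsqf (q : ℤ) ⟨e₁, by ring⟩)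
    · obtain ⟨e', rfl⟩ := h4
      have hm : e * e' = 448 * p ^ 2 := mul_left_cancel₀ hq0 (by linear_combination h1)
      exact not_isSoluble_padic_of_prime_dvd_coeffs (p := q) (c := -42 * p) (by ring) rfl rfl hm hns_disc_q (hpadic q)
  -- `d ∣ 14qp` prime to `q`: `d ∣ 14p`
  have h0 : d ∣ 448 * ((q : ℤ) * p) ^ 2 := ⟨d', hdd'⟩
  have h1 : d ∣ (14 * ((q : ℤ) * p)) ^ 6 := h0.trans ⟨16807 * ((q : ℤ) * p) ^ 4, by ring⟩
  have h14qp : d ∣ 14 * ((q : ℤ) * p) := (hsqf.dvd_pow_iff_dvd (by norm_num)).mp h1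
  have hcopq : IsCoprime d (q : ℤ) := ((hqZ.irreducible.coprime_iff_not_dvd).mpr hqd).symm
  have h14p : d ∣ 14 * (p : ℤ) := by
    have : d ∣ (q : ℤ) * (14 * p) := by rw [show (q : ℤ) * (14 * p) = 14 * (q * p) by ring]; exact h14qp
    exact hcopq.dvd_of_dvd_mul_left this
  by_cases hpd : (p : ℤ) ∣ d
  · -- `d = p·e`, `e ∣ 14`: `p, 7p` die at `p`; `2p, 14p` at `2`
    exfalso
    obtain ⟨e, rfl⟩ := hpd
    have he14 : e ∣ 14 := by
      have : (p : ℤ) * e ∣ (p : ℤ) * 14 := by rw [mul_comm (p : ℤ) 14]; exact h14p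
      exact (mul_dvd_mul_iff_left hp0).mp this
    have hepos : 0 < e := pos_of_mul_pos_right hdpos (by positivity)
    have hele : e ≤ 14 := Int.le_of_dvd (by norm_num) he14
    have hd'e : e * d' = 448 * q ^ 2 * p := mul_left_cancel₀ hp0 (by linear_combination (-1 : ℤ) * hdd')
    interval_cases e <;> try omega
    · -- `d = p`: `d′ = p·448q²`
      exact not_isSoluble_padic_class_p_plusPOneAlpha hp8 hp7 hα h7sq hqsq h448q rfl
        (show d' = (p : ℤ) * (448 * (q : ℤ) ^ 2) by linarith) (hpadic p)
    · -- `d = 2p`: dies at `2`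
      exact not_isSoluble_two_class_twoP_plusPOne hq8 hp8 rfl (by ring)
        (show d' = 224 * ((q : ℤ) ^ 2 * p) by linarith) (hpadic 2)
    · -- `d = 7p`: `d′ = p·64q²`
      exact not_isSoluble_padic_class_sevenP_plusPOneAlpha hp8 hp7 hα hqsq h64q rfl
        (show d' = (p : ℤ) * (64 * (q : ℤ) ^ 2) by linarith) (hpadic p)
    · -- `d = 14p`: dies at `2`
      exact not_isSoluble_two_class_fourteenP_plusPOne hq8 hp8 rfl (by ring)
        (show d' = 32 * ((q : ℤ) ^ 2 * p) by linarith) (hpadic 2)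
  · -- `d ∣ 14`, `d > 0`: `2, 14` die at `2`
    have hcopp : IsCoprime d (p : ℤ) := ((hpZ.irreducible.coprime_iff_not_dvd).mpr hpd).symm
    have hd14 : d ∣ 14 := hcopp.dvd_of_dvd_mul_right h14p
    have hle : d ≤ 14 := Int.le_of_dvd (by norm_num) hd14
    simp only [Finset.mem_insert, Finset.mem_singleton]
    interval_cases d <;> try omega
    · exact absurd (hpadic 2) (not_isSoluble_two_class_two_even (u := -((q : ℤ) * p)) h8 (by ring) rfl (by rw [neg_sq]; linarith))
    · exact absurd (hpadic 2) (not_isSoluble_two_class_fourteen_even (u := -((q : ℤ) * p)) h8 (by ring) rfl (by rw [neg_sq]; linarith))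

/-- **`#S(−42qp, 448q²p²) ≤ 2`** on a71+ (sharp: the image `{1, 7}` of `W(ℚ)/φ̂W′(ℚ)`). [cite: SilvermanAEC2009, Prop. X.4.9 and Example X.4.10] -/
theorem card_twoIsogenySelmerGroup_twoPrimesTwist_le_two_plusPOneAlpha (hq8 : q % 8 = 7) (hq7 : jacobiSym q 7 = -1) (hp8 : p % 8 = 1)
    (hp7 : legendreSym p (-7) = 1) (hα : ¬ ∃ x : ZMod p, x ^ 4 = -7) (hpq : jacobiSym p q = 1) :
    (twoIsogenySelmerGroup (-42 * ((q : ℤ) * p)) (448 * ((q : ℤ) * p) ^ 2)).card ≤ 2 :=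
  (Finset.card_le_card (twoIsogenySelmerGroup_twoPrimesTwist_subset_pair_plusPOneAlpha hq8 hq7 hp8 hp7 hα hpq)).trans Finset.card_le_two

end SelmerS

end Summit.BirchSwinnertonDyer.BirchSwinnertonDyer.Theorems.GoldfeldGoodTwists

end
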